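import Mathlib
import Summits.MatrixMultiplication.MatrixMultiplication.Theorems.SnSubsetDichotomyNoThresholdSubsetTripleSqChange
import Summits.MatrixMultiplication.MatrixMultiplication.Theorems.SnSubsetDichotomyNoThresholdSubsetTripleIncrBounded
import Summits.MatrixMultiplication.MatrixMultiplication.Theorems.SnSubsetDichotomyNoThresholdSubsetTripleSqEnergyBounded

/-!
# (L2) on a box: bounded one-step change of `q` for diagrams with bounded rows and columns

Line `klr-graded-polynomial-method`, crux `SnSubsetDichotomy.NoThresholdSubsetTriple` (stmt-MatrixMultiplication-8302), lead c7 report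
§2a/app. A.  For a Young diagram all of whose cells have row `< R` and column `< K` (the J′ box is `R = K = ⌈3√n⌉`):
`q(ν) ≤ (R+K)²` and `|q(ν ∪ z) − q(ν)| ≤ 6(R+K) + 11/3` for every corner `z` — hypothesis (L2) of the (Q)-lemma
`selfBounding_timeSum_tail` (p152256) for `q_t = sqEnergy ν_t`, composed from `sq_change_le` (L2′, p155265),
`abs_incr_le_of_bounded` (p155844) and `sqEnergy_le_sq_of_abs_incr_le` (p155776).
-/

open scoped BigOperators
open Literature.RepresentationTheory.FiniteGroups (addableNodes IsAddableNode)

namespace Summit.MatrixMultiplication.MatrixMultiplication.Theorems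

open PlancherelStep

set_option linter.dupNamespace false in
/-- On a box: `q(ν) ≤ (R + K)²` when every cell of the Young diagram `ν` has row `< R` and column `< K`. [lead c7 report app. A] -/
theorem sqEnergy_le_of_box : ∀ (ν : Finset (ℕ × ℕ)), IsLowerSet (ν : Set (ℕ × ℕ)) → ∀ (R K : ℕ),
    (∀ x ∈ ν, x.1 < R ∧ x.2 < K) → sqEnergy ν ≤ ((R + K : ℕ) : ℝ) ^ 2 :=
  fun ν hν R K hbox =>
    sqEnergy_le_sq_of_abs_incr_le ν hν (R + K) fun y _ => abs_incr_le_of_bounded ν R K hbox y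

set_option linter.dupNamespace false in
/-- **(L2) on a box**: `|q(ν ∪ z) − q(ν)| ≤ 6(R + K) + 11/3` for every corner `z` of a Young diagram `ν` whose cells have row `< R`
and column `< K` (from (L2′) `sq_change_le` and `√q ≤ R + K`). [lead c7 report app. A] -/
theorem sq_change_le_of_box : ∀ (ν : Finset (ℕ × ℕ)), IsLowerSet (ν : Set (ℕ × ℕ)) → ∀ (R K : ℕ),
    (∀ x ∈ ν, x.1 < R ∧ x.2 < K) → ∀ (z : ℕ × ℕ), z ∈ addableNodes ν →
      |sqEnergy (insert z ν) - sqEnergy ν| ≤ 6 * ((R + K : ℕ) : ℝ) + 11 / 3 := by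
  intro ν hν R K hbox z hz
  have h1 := sq_change_le ν hν z hz
  have h2 : Real.sqrt (sqEnergy ν) ≤ ((R + K : ℕ) : ℝ) := by
    rw [Real.sqrt_le_left (by positivity)]
    exact sqEnergy_le_of_box ν hν R K hbox
  linarith

end Summit.MatrixMultiplication.MatrixMultiplication.Theorems
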